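import Summits.RiemannHypothesis.RiemannHypothesis.Theses.LeeYang
import Summits.RiemannHypothesis.RiemannHypothesis.Theorems.LeeYangLeeyangNegStubBoundary

/-!
# Skeleton — crux `LeeYang.LeeyangNeg` (stmt-RiemannHypothesis-0457), line `Sketch-ideator1`
(idea cards `Cruxes/LeeyangNeg/Ideas/tilt-extremal-factor.md` (+ `cw-projection-ursell.md`),
ideator round 1, ideator 1; lead prover-line-stmt-RiemannHypothesis-0457-a1-0, 2026-08-16)

Reconstructed from the card (`What it needs` K1–K3, P2, P3 and `Assembly sketch`): the ideator's
own file `Sketch-ideator1.lean` lives in the gate's evidence store, which is not mounted in a seat's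
jail. The crux is `¬ IsIsingLimitLaw ν_Φ` for the de Bruijn law `ν_Φ = Φ du / ∫Φ`
(`Φ = Literature.NumberTheory.LFunctions.deBruijnPhi`). The card's transfer
`DeBruijnLawTiltExtremal → TiltExtremalFactor → XiNoGappedGSFactor → LeeyangNeg`
(`leeyangNeg_of_factor_structure`, P3) is composed here from three stubs, all signatures inline in
the tree's vocabulary (no local definitions; "`Λ_DN(μ) < 0`" is spelled "some Gaussian anti-tilt
`e^{-δu²} μ`, `δ > 0`, has the Lee–Yang property", "`Λ_DN(μ) = 0` on the GS side" is spelled "no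
Gaussian anti-tilt has it"):

* `stub_boundary` (P2 `DeBruijnLawTiltExtremal`, LANDED p103378 by the previous lead as
  `Theorems/LeeYangLeeyangNegStubBoundary.lean`, imported, namespace `…LeeYangProductTowers`):
  `ν_Φ` is ON the Lee–Yang boundary — every anti-tilt `e^{-cu²} ν_Φ`, `c > 0`, fails Lee–Yang
  (`rodgers_tao_holds`).
* `stub_tiltExtremalFactor` (K1 = S1 `TiltExtremalFactor`): an Ising limit law on the Lee–Yang
  boundary is a non-trivial convolution `ν₁ ∗ ν₂` of Ising limit laws with `ν₁` GAPPED
  (`Λ(ν₁) < 0`: some anti-tilt of `ν₁` is still Lee–Yang). Card: "level repulsion — the Lee–Yang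
  zeros of a CONNECTED finite ferromagnet never collide (R1 `ConnectedFerromagnetNegativeLambda`),
  so inside GS the boundary value Λ = 0 can only arise from (asymptotic) disconnection".
* `stub_xiNoGappedGSFactor` (K2 = S2 `XiNoGappedGSFactor`): `ν_Φ` has no such factorisation
  (finite / commensurable factors by Putnam-type "no arithmetic progressions of zeta zeros";
  general factors by the all-height zero partition against pair correlation, RH being available
  because X ⇒ RH).

`LeeyangNeg_of` concludes the crux BY NAME from the stubs (sorry only in `stub_*`).
-/

noncomputable section

-- the sub-problem path `RiemannHypothesis/RiemannHypothesis` (single-conjunct summit, D-0017) duplicates a namespace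
set_option linter.dupNamespace false

open MeasureTheory

namespace Summit.RiemannHypothesis.RiemannHypothesis.Theorems.LeeYangTiltFactor

open Literature.Probability.LatticeModels Literature.NumberTheory.LFunctions

-- stub_boundary (P2): LANDED p103378 — imported from
-- `Summits.RiemannHypothesis.RiemannHypothesis.Theorems.LeeYangLeeyangNegStubBoundary`
-- (`Summit.RiemannHypothesis.RiemannHypothesis.Theorems.LeeYangProductTowers.stub_boundary`).

/-- **Stub S1 (`TiltExtremalFactor`) — tilt-extremal Ising limit laws factor.** If `ν` is an
Ising limit law and no Gaussian anti-tilt `e^{-cu²} ν` (`c > 0`) has the Lee–Yang property, then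
`ν = ν₁ ∗ ν₂` with `ν₁, ν₂` Ising limit laws, both `≠ δ₀`, and `ν₁` gapped: some anti-tilt
`e^{-δu²} ν₁`, `δ > 0`, has the Lee–Yang property. -/
theorem stub_tiltExtremalFactor : ∀ ν : ProbabilityMeasure ℝ, IsIsingLimitLaw ν →
    (∀ c : ℝ, 0 < c →
      ¬ HasLeeYangProperty
        ((ν : Measure ℝ).withDensity fun u => ENNReal.ofReal (Real.exp (-(c * u ^ 2))))) →
    ∃ ν₁ ν₂ : ProbabilityMeasure ℝ, IsIsingLimitLaw ν₁ ∧ IsIsingLimitLaw ν₂ ∧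
      (∃ δ : ℝ, 0 < δ ∧
        HasLeeYangProperty
          ((ν₁ : Measure ℝ).withDensity fun u => ENNReal.ofReal (Real.exp (-(δ * u ^ 2))))) ∧
      (ν₁ : Measure ℝ) ≠ Measure.dirac 0 ∧ (ν₂ : Measure ℝ) ≠ Measure.dirac 0 ∧
      (ν : Measure ℝ) = Measure.conv (ν₁ : Measure ℝ) (ν₂ : Measure ℝ) := by
  sorry

/-- **Stub S2 (`XiNoGappedGSFactor`) — `ν_Φ` has no gapped Ising-limit factor.** The de Bruijn
law is not a convolution `ν₁ ∗ ν₂` of Ising limit laws, both `≠ δ₀`, with `ν₁` gapped (some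
Gaussian anti-tilt of `ν₁` Lee–Yang). -/
theorem stub_xiNoGappedGSFactor : ∀ ν : ProbabilityMeasure ℝ,
    (ν : Measure ℝ) = (∫⁻ u, ENNReal.ofReal (deBruijnPhi u))⁻¹ •
        volume.withDensity (fun u => ENNReal.ofReal (deBruijnPhi u)) →
    ¬ ∃ ν₁ ν₂ : ProbabilityMeasure ℝ, IsIsingLimitLaw ν₁ ∧ IsIsingLimitLaw ν₂ ∧
      (∃ δ : ℝ, 0 < δ ∧
        HasLeeYangProperty
          ((ν₁ : Measure ℝ).withDensity fun u => ENNReal.ofReal (Real.exp (-(δ * u ^ 2))))) ∧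
      (ν₁ : Measure ℝ) ≠ Measure.dirac 0 ∧ (ν₂ : Measure ℝ) ≠ Measure.dirac 0 ∧
      (ν : Measure ℝ) = Measure.conv (ν₁ : Measure ℝ) (ν₂ : Measure ℝ) := by
  sorry

/-- **Composition (`leeyangNeg_of_factor_structure`).** The crux `LeeyangNeg`
(`¬ IsIsingLimitLaw ν_Φ`) from the stubs: an Ising-limit witness for `ν_Φ` would sit on the
Lee–Yang boundary (`stub_boundary`), hence factor with a gapped Ising-limit factor (S1),
contradicting S2. -/
theorem LeeyangNeg_of :
    Summit.RiemannHypothesis.RiemannHypothesis.Theses.LeeYang.LeeyangNeg := by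
  intro ν hν hGS
  exact stub_xiNoGappedGSFactor ν hν
    (stub_tiltExtremalFactor ν hGS (LeeYangProductTowers.stub_boundary ν hν))

end Summit.RiemannHypothesis.RiemannHypothesis.Theorems.LeeYangTiltFactor

end
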